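import Summits.Schanuel.Schanuel.Theorems.DiophantineDichotomyKhovanskiiApproxTypeEvDefs
import HarnessLib

/-!
# Route `DiophantineDichotomy`, crux `KhovanskiiApproxTypeEv`, line `anchored-reduction`:
# the `dᵇ` term of the eventual crux is idle

Crux `Summit.Schanuel.Schanuel.Theses.DiophantineDichotomy.KhovanskiiApproxTypeEv`
(item stmt-Schanuel-14972), line `anchored-reduction` (skeleton `Cruxes/KhovanskiiApproxTypeEv/
Lines/Sketch.lean`).  The crux asks, at every free Khovanskii point `θ = (s, e^s) ∈ ℂ²ⁿ`, for
`a < 1/(n−1)`, `b`, `C > 0` with `‖γ − θ‖ ≥ exp(−C(dᵃ log H + dᵇ))` for all `H ≥ H₀(d)` and all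
algebraic challengers `γ` of level `(d, H)` (`ApproxTypeEvAt n s a b C`).  Because the threshold
`H₀(d)` may depend on `d`, the `dᵇ` term is IDLE:

* for fixed `d ≥ 1` it is a constant, absorbed by raising the threshold to `H ≥ exp(d^{b−a})`:
  then `dᵇ = dᵃ·d^{b−a} ≤ dᵃ log H`, so `C(dᵃ log H + dᵇ) ≤ 2C·dᵃ log H ≤ 2C(dᵃ log H + d^{b'})`;
* for `d = 0` there is no admissible challenger at all: every coordinate of `γ` is a root of a
  non-zero integer polynomial, so `ℚ(γ)/ℚ` is a finite extension and `[ℚ(γ):ℚ] ≥ 1 > 0 = d`,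
  i.e. the implication is vacuous.

## Contents (nothing is credited to the summit)

* `approxTypeEvAt_indep_b` (registered stub) —
  `ApproxTypeEvAt n s a b C → ApproxTypeEvAt n s a b' (2 * C)` for ALL `b, b'`;
* `khovanskiiApproxTypeEv_iff_bZero` (registered corollary) — the crux restated with `b = 0`, i.e.
  in the two parameters `(a, C)`: the kernel-checked input for re-filing the crux without `b`.
-/

noncomputable section

-- `Summit.Schanuel.Schanuel.…` is the mandated summit/sub-problem namespace (single-conjunct summit), hence:
set_option linter.dupNamespace false

namespace Summit.Schanuel.Schanuel.Cruxes.KhovanskiiApproxTypeEv.AnchoredReduction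

open Summit.Schanuel.Schanuel.Theses.DiophantineDichotomy (KhovanskiiApproxTypeEv)
open Summit.Schanuel.Schanuel.Cruxes.KhovanskiiApproxType.LwSmallHeight (IsFreeKhovanskii)

/-! ## No challenger has degree budget `d = 0` -/

/-- A root of a non-zero integer polynomial is integral over `ℚ` (map the polynomial along
`ℤ → ℚ`, then `isAlgebraic_iff_isIntegral`). [folklore] -/
private theorem isIntegral_of_root {P : Polynomial ℤ} {z : ℂ} (hP : P ≠ 0)
    (hz : Polynomial.aeval z P = 0) : IsIntegral ℚ z := by
  refine isAlgebraic_iff_isIntegral.mp ⟨P.map (algebraMap ℤ ℚ), ?_, ?_⟩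
  · exact (Polynomial.map_ne_zero_iff (algebraMap ℤ ℚ).injective_int).mpr hP
  · rw [Polynomial.aeval_map_algebraMap, hz]

/-- If every coordinate of a finite tuple `γ` is a root of a non-zero integer polynomial then
`ℚ(γ)/ℚ` is finite (`IntermediateField.finiteDimensional_adjoin`), hence `0 < [ℚ(γ):ℚ]`
(uniformly in the index type, including the empty tuple where `ℚ(γ) = ℚ`). [folklore] -/
private theorem finrank_adjoin_pos {ι : Type*} [Finite ι] {γ : ι → ℂ}
    (hroot : ∀ i, ∃ P : Polynomial ℤ, P ≠ 0 ∧ Polynomial.aeval (γ i) P = 0) :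
    0 < Module.finrank ℚ ↥(IntermediateField.adjoin ℚ (Set.range γ)) := by
  haveI : FiniteDimensional ℚ ↥(IntermediateField.adjoin ℚ (Set.range γ)) := by
    refine IntermediateField.finiteDimensional_adjoin ?_
    rintro _ ⟨i, rfl⟩
    obtain ⟨P, hP, hz⟩ := hroot i
    exact isIntegral_of_root hP hz
  exact Module.finrank_pos

/-! ## The `dᵇ` term is idle -/

/-- **Registered stub `approxTypeEvAt_indep_b` — the `dᵇ` term of the eventual type is idle.**
An eventual approximation type `(a, b, C)` at `θ = (s, e^s)` is an eventual approximation type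
`(a, b', 2C)` for EVERY `b'`: at `d = 0` there is no admissible challenger (`[ℚ(γ):ℚ] ≥ 1`,
`finrank_adjoin_pos`), and at `d ≥ 1` the threshold `H ≥ max(H₀(d), ⌈exp(d^{b−a})⌉)` gives
`d^{b−a} ≤ log H`, so `dᵇ = dᵃ d^{b−a} ≤ dᵃ log H` and
`C(dᵃ log H + dᵇ) ≤ 2C dᵃ log H ≤ 2C(dᵃ log H + d^{b'})`. [folklore] -/
theorem approxTypeEvAt_indep_b : ∀ (n : ℕ) (s : Fin n → ℂ) (a b b' C : ℝ),
    ApproxTypeEvAt n s a b C → ApproxTypeEvAt n s a b' (2 * C) := by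
  rintro n s a b b' C ⟨hC, hall⟩
  refine ⟨by positivity, fun d => ?_⟩
  obtain ⟨H₀, hH₀⟩ := hall d
  rcases Nat.eq_zero_or_pos d with rfl | hd
  · -- `d = 0`: no admissible challenger, the implication is vacuous
    refine ⟨0, fun H γ _ hdeg hroot => ?_⟩
    exfalso
    have hpos := finrank_adjoin_pos (γ := γ) fun i => ?_
    · omega
    obtain ⟨P, hP, -, -, hz⟩ := hroot i
    exact ⟨P, hP, hz⟩
  · -- `d ≥ 1`: raise the threshold to absorb `dᵇ` into `dᵃ log H`
    refine ⟨max H₀ ⌈Real.exp ((d : ℝ) ^ (b - a))⌉₊, fun H γ hH hdeg hroot => ?_⟩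
    have hH₀H : H₀ ≤ H := (le_max_left _ _).trans hH
    have hceil : ⌈Real.exp ((d : ℝ) ^ (b - a))⌉₊ ≤ H := (le_max_right _ _).trans hH
    have hexpH : Real.exp ((d : ℝ) ^ (b - a)) ≤ (H : ℝ) :=
      (Nat.le_ceil _).trans (by exact_mod_cast hceil)
    have hHpos : (0 : ℝ) < H := (Real.exp_pos _).trans_le hexpH
    have hlogH : (d : ℝ) ^ (b - a) ≤ Real.log H := (Real.le_log_iff_exp_le hHpos).2 hexpH
    have hdpos : (0 : ℝ) < d := by exact_mod_cast hd
    have hda : 0 ≤ (d : ℝ) ^ a := Real.rpow_nonneg hdpos.le a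
    have hdb' : 0 ≤ (d : ℝ) ^ b' := Real.rpow_nonneg hdpos.le b'
    have hlog0 : 0 ≤ Real.log H := (Real.rpow_nonneg hdpos.le _).trans hlogH
    have hsplit : (d : ℝ) ^ b = (d : ℝ) ^ a * (d : ℝ) ^ (b - a) := by
      have hab : a + (b - a) = b := by ring
      rw [← Real.rpow_add hdpos, hab]
    have hkey : (d : ℝ) ^ b ≤ (d : ℝ) ^ a * Real.log H := by
      rw [hsplit]
      exact mul_le_mul_of_nonneg_left hlogH hda
    have hineq : C * ((d : ℝ) ^ a * Real.log H + (d : ℝ) ^ b) ≤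
        2 * C * ((d : ℝ) ^ a * Real.log H + (d : ℝ) ^ b') := by
      have h1 : (d : ℝ) ^ a * Real.log H + (d : ℝ) ^ b ≤
          2 * ((d : ℝ) ^ a * Real.log H + (d : ℝ) ^ b') := by
        nlinarith [mul_nonneg hda hlog0]
      have h2 := mul_le_mul_of_nonneg_left h1 hC.le
      linarith
    exact (Real.exp_le_exp.2 (neg_le_neg hineq)).trans (hH₀ H γ hH₀H hdeg hroot)

/-- **Registered corollary `khovanskiiApproxTypeEv_iff_bZero` — the crux in two parameters.**
`KhovanskiiApproxTypeEv` is equivalent to its `b = 0` instance: every free Khovanskii point of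
`ℂⁿ`, `n ≥ 2`, with `ℚ`-linearly independent coordinates has an eventual approximation type
`(a, 0, C)` with `a < 1/(n−1)` (`khovanskiiApproxTypeEv_iff` + `approxTypeEvAt_indep_b`). [folklore] -/
theorem khovanskiiApproxTypeEv_iff_bZero : KhovanskiiApproxTypeEv ↔ ∀ (n : ℕ) (s : Fin n → ℂ),
    2 ≤ n → LinearIndependent ℚ s → IsFreeKhovanskii n s →
      ∃ a C : ℝ, a < 1 / ((n : ℝ) - 1) ∧ ApproxTypeEvAt n s a 0 C := by
  rw [khovanskiiApproxTypeEv_iff]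
  refine ⟨fun h n s hn hs hfree => ?_, fun h n s hn hs hfree => ?_⟩
  · obtain ⟨a, b, C, ha, hAT⟩ := h n s hn hs hfree
    exact ⟨a, 2 * C, ha, approxTypeEvAt_indep_b n s a b 0 C hAT⟩
  · obtain ⟨a, C, ha, hAT⟩ := h n s hn hs hfree
    exact ⟨a, 0, C, ha, hAT⟩

end Summit.Schanuel.Schanuel.Cruxes.KhovanskiiApproxTypeEv.AnchoredReduction

end
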